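import Mathlib.Data.Bool.Count
import Literature.Barriers.CriticalPhenomena.RigorousRGSmallParameterTphiCalculus
import HarnessLib

/-!
# `RigorousRGSmallParameter` (Slade, Theorem 1.4.1): the `T_φ` seminorm of [BS-rg-norm] —
# III. The lattice test-function norms `Φ_j(𝔥)` (Slade (6.28)), their shuffle property, and the
# product property of Slade's `T_{φ,j}(𝔥_j)` seminorm

Sequel of `RigorousRGSmallParameterTphiSeminorm.lean` and `…TphiCalculus.lean` (see the first for
the sources and architecture). Brydges–Slade, Definition 3.3.1 and Example 3.3.2: the norm on test
functions `g : 𝚲^* → ℝ` is `‖g‖_Φ = sup_{(α,z)} w_{α,z}⁻¹|∇^α g_z|`, where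
`(∇^α g)_z = ∇^{α_1}_{z_1}⋯∇^{α_r}_{z_r} g_{z_1,…,z_r}` ("each `α_k` is a multi-index which
specifies finite-difference derivatives with respect to the variable `z_k`", `∇^e f_x = f_{x+e}-f_x`
for the `2d` unit vectors `e`), with the weights `w^{-1}_{α_k,z_k} = 𝔥^{-1}R^{|α_k|_1}` if
`|α_k|_1 ≤ p_Φ` and `0` otherwise, `R = L^j`: "test functions in the unit ball `B(Φ)` are those
which obey the estimate `|∇^α g_z| ≤ 𝔥^z R^{-α}` … for all `α` with `|α_k|_1 ≤ p_Φ` for each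
component `α_k`". Slade §6.2.1, (6.28): `‖g‖_{Φ_j(𝔥_j)} = sup_{z} sup_{|a| ≤ p_Φ} 𝔥_j^{-p}L^{j|a|}|∇^a g_z|`,
`p_Φ = 4` — the same norm ("We recall the definitions of several norms from [BS-rg-norm, BS-rg-step]";
the restriction `|a| ≤ p_Φ` is per argument, as in Example 3.3.2 — with a bound only on the total
number of differences the product property would fail), and §6.2.2: the `T_{φ,j}(𝔥)` seminorm
`‖F‖ = sup_{‖g‖_{Φ_j(𝔥)} ≤ 1} |⟨F,g⟩_φ|`.

## What this file proves (everything; no named fact)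

The torus is any additive commutative group `Λ` (for Slade `ℤ^d/L^Nℤ^d`), the unit vectors any
family `step : S → Λ` (for Slade `{±e_1,…,±e_d}`), the field labels `𝚲 = Λ × ι` (`ι = {1,…,n}`).
A multi-derivative `∇^α` is encoded by a programme `α`: a list of (argument position, direction)
pairs, `|α_k|_1` being the number of entries at position `k` (`countAt`), `|α| = Σ_k|α_k|_1` its
length; `Adm p_Φ r α` says positions are `< r` and `|α_k|_1 ≤ p_Φ`.

* `shiftAt`, `diffOp` (`∇^s` on the `k`-th argument), `napply` (`∇^α`), with linearity, locality
  (`napply_congr`); `tpos`/`fpos` (positions inside an interleaving) with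
  `merge_modify_left/right`, injectivity and disjointness; `mergeProg`, **`adm_mergeProg`** (the
  programme transported to an interleaving is admissible); **`napply_maskAvg_left/right`** — `∇` in
  either variable of a shuffle average is the shuffle average of the transported `∇`;
* `latticeFun 𝔥 R α z` (the functional `λ_{α,z} = 𝔥^{-|z|}R^{|α|}∇^α(·)_z`), `latticeFamily`
  (all admissible ones: its `ball` is `B(Φ_j(𝔥))`), `abs_napply_le_of_mem_ball`
  (`|∇^αg_z| ≤ 𝔥^{|z|}R^{-|α|}` on the ball), `latticeFamily_evalBound`, `indicator_nil_mem_ball`,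
  and **`latticeFamily_shuffleCompat`** — the shuffle property, i.e. the last step
  "`|λ_{α'',z''}λ_{α',z'}g_z| ≤ 1`" of the proof of Proposition 5.1.2 for these norms;
* consequences: **`TphiNorm_mul_le_lattice`** (Proposition 3.4.5 for `Φ(𝔥)`, hence for Slade's
  `T_{φ,j}(𝔥_j)`), `abs_apply_le_TphiNorm_lattice` (`|F(φ)| ≤ ‖F‖_{T_φ}`),
  `TphiNorm_add_le_lattice`, `abs_TphiPairing_le_lattice`;
* products of test functions in separate variables: `napply_prod`, `adm_progLeft/Right`, `prodFn`,
  **`prodFn_polar`** (`‖g'⊗g''‖_Φ ≤ ‖g'‖‖g''‖`, the display after Example 3.3.2), and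
  **`abs_iteratedFDeriv_two_le_lattice`** — Slade's display (8.24) in the proof of Corollary 8.1.6:
  `|D²F(φ; f, f)| ≤ 2‖F‖_{T_φ}‖f‖²_Φ` for a direction `f` in the span of the coordinate directions.

Ledger effect: none on the trust base of the barrier's reduction chain (`Slade2017_prop822`); with
its two prequels this is the `T_φ`/`Φ_j` layer of the norms of Slade's §6.2 (the regulators and the
`𝒲_j` norm of §6.2.3, and the localisation operator of §4.2, are not treated here).
-/

noncomputable section

namespace Literature.Barriers.CriticalPhenomena

namespace LongRangePhi4

namespace Tphi

open Finset

variable {Ξ : Type*}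


/-! ## Lattice test-function norms `Φ_j(𝔥)`: finite-difference functionals and the shuffle property -/

section lattice

/-! ### Modifying one entry of a sequence; positions inside a merge -/

/-- Position of the `k`-th `true` of a mask. [folklore] -/
def tpos : List Bool → ℕ → ℕ
  | [], k => k
  | true :: _, 0 => 0
  | true :: m, k + 1 => tpos m k + 1
  | false :: m, k => tpos m k + 1

/-- Position of the `k`-th `false` of a mask. [folklore] -/
def fpos : List Bool → ℕ → ℕ
  | [], k => k
  | false :: _, 0 => 0
  | false :: m, k + 1 => fpos m k + 1
  | true :: m, k => fpos m k + 1

/-- `tpos (true·m) 0 = 0`. [folklore] -/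
@[simp] theorem tpos_true_zero (m : List Bool) : tpos (true :: m) 0 = 0 := rfl
/-- `tpos (true·m) (k+1) = tpos m k + 1`. [folklore] -/
@[simp] theorem tpos_true_succ (m : List Bool) (k : ℕ) : tpos (true :: m) (k + 1) = tpos m k + 1 := rfl
/-- `tpos (false·m) k = tpos m k + 1`. [folklore] -/
@[simp] theorem tpos_false (m : List Bool) (k : ℕ) : tpos (false :: m) k = tpos m k + 1 := by
  cases k <;> rfl
/-- `fpos (false·m) 0 = 0`. [folklore] -/
@[simp] theorem fpos_false_zero (m : List Bool) : fpos (false :: m) 0 = 0 := rfl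
/-- `fpos (false·m) (k+1) = fpos m k + 1`. [folklore] -/
@[simp] theorem fpos_false_succ (m : List Bool) (k : ℕ) : fpos (false :: m) (k + 1) = fpos m k + 1 := rfl
/-- `fpos (true·m) k = fpos m k + 1`. [folklore] -/
@[simp] theorem fpos_true (m : List Bool) (k : ℕ) : fpos (true :: m) k = fpos m k + 1 := by
  cases k <;> rfl

/-- A mask in `masks k l` has `k` entries `true` and `l` entries `false`. [folklore] -/
theorem count_of_mem_masks : ∀ {k l : ℕ} {m : List Bool}, m ∈ masks k l →
    m.count true = k ∧ m.count false = l
  | 0, l, m, hm => by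
      simp only [masks_zero, List.mem_singleton] at hm
      subst hm
      simp [List.count_replicate]
  | k + 1, 0, m, hm => by
      rw [masks_succ_zero, List.mem_singleton] at hm
      subst hm
      simp [List.count_replicate]
  | k + 1, l + 1, m, hm => by
      rw [masks_succ_succ, List.mem_append, List.mem_map, List.mem_map] at hm
      rcases hm with ⟨m', hm', rfl⟩ | ⟨m', hm', rfl⟩
      · have := count_of_mem_masks hm'
        simp [this.1, this.2]
      · have := count_of_mem_masks hm'
        simp [this.1, this.2]
termination_by k l => k + l

/-- Merging commutes with modifying an entry of the first sequence, the position being relocated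
by `tpos`. [folklore] -/
theorem merge_modify_left {α : Type*} (f : α → α) : ∀ (m : List Bool) (k : ℕ) (u v : List α),
    m.count true = u.length → m.count false = v.length →
      merge m (u.modify k f) v = (merge m u v).modify (tpos m k) f
  | [], k, u, v, _, _ => by simp
  | true :: m, k, u, v, hu, hv => by
      cases u with
      | nil => simp at hu
      | cons a u =>
        simp only [List.count_cons_self, List.length_cons, add_left_inj] at hu
        have hv' : m.count false = v.length := by simpa using hv
        cases k with
        | zero => simp
        | succ k => simp [merge_modify_left f m k u v hu hv']
  | false :: m, k, u, v, hu, hv => by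
      cases v with
      | nil => simp at hv
      | cons b v =>
        simp only [List.count_cons_self, List.length_cons, add_left_inj] at hv
        have hu' : m.count true = u.length := by simpa using hu
        simp [merge_modify_left f m k u v hu' hv]

/-- Merging commutes with modifying an entry of the second sequence (position relocated by `fpos`).
[folklore] -/
theorem merge_modify_right {α : Type*} (f : α → α) : ∀ (m : List Bool) (k : ℕ) (u v : List α),
    m.count true = u.length → m.count false = v.length →
      merge m u (v.modify k f) = (merge m u v).modify (fpos m k) f
  | [], k, u, v, _, _ => by simp
  | false :: m, k, u, v, hu, hv => by
      cases v with
      | nil => simp at hv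
      | cons b v =>
        simp only [List.count_cons_self, List.length_cons, add_left_inj] at hv
        have hu' : m.count true = u.length := by simpa using hu
        cases k with
        | zero => simp
        | succ k => simp [merge_modify_right f m k u v hu' hv]
  | true :: m, k, u, v, hu, hv => by
      cases u with
      | nil => simp at hu
      | cons a u =>
        simp only [List.count_cons_self, List.length_cons, add_left_inj] at hu
        have hv' : m.count false = v.length := by simpa using hv
        simp [merge_modify_right f m k u v hu hv']

/-- The position of the `k`-th `true` is inside the mask. [folklore] -/
theorem tpos_lt : ∀ (m : List Bool) (k : ℕ), k < m.count true → tpos m k < m.length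
  | [], k, hk => by simp at hk
  | true :: m, 0, _ => by simp
  | true :: m, k + 1, hk => by
      have : k < m.count true := by simpa using hk
      simpa using tpos_lt m k this
  | false :: m, k, hk => by
      have : k < m.count true := by simpa using hk
      simpa using tpos_lt m k this

/-- The position of the `k`-th `false` is inside the mask. [folklore] -/
theorem fpos_lt : ∀ (m : List Bool) (k : ℕ), k < m.count false → fpos m k < m.length
  | [], k, hk => by simp at hk
  | false :: m, 0, _ => by simp
  | false :: m, k + 1, hk => by
      have : k < m.count false := by simpa using hk
      simpa using fpos_lt m k this
  | true :: m, k, hk => by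
      have : k < m.count false := by simpa using hk
      simpa using fpos_lt m k this

/-- `tpos m` is injective. [folklore] -/
theorem tpos_injective : ∀ (m : List Bool) {k k' : ℕ}, tpos m k = tpos m k' → k = k'
  | [], k, k', h => h
  | true :: m, 0, 0, _ => rfl
  | true :: m, 0, k' + 1, h => by simp at h
  | true :: m, k + 1, 0, h => by simp at h
  | true :: m, k + 1, k' + 1, h => by
      have : tpos m k = tpos m k' := by simpa using h
      rw [tpos_injective m this]
  | false :: m, k, k', h => by
      have : tpos m k = tpos m k' := by simpa using h
      exact tpos_injective m this

/-- `fpos m` is injective. [folklore] -/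
theorem fpos_injective : ∀ (m : List Bool) {k k' : ℕ}, fpos m k = fpos m k' → k = k'
  | [], k, k', h => h
  | false :: m, 0, 0, _ => rfl
  | false :: m, 0, k' + 1, h => by simp at h
  | false :: m, k + 1, 0, h => by simp at h
  | false :: m, k + 1, k' + 1, h => by
      have : fpos m k = fpos m k' := by simpa using h
      rw [fpos_injective m this]
  | true :: m, k, k', h => by
      have : fpos m k = fpos m k' := by simpa using h
      exact fpos_injective m this

/-- A position of the merged sequence comes from exactly one of the two sequences. [folklore] -/
theorem tpos_ne_fpos : ∀ (m : List Bool) {k k' : ℕ}, k < m.count true → k' < m.count false →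
    tpos m k ≠ fpos m k'
  | [], k, k', hk, _ => by simp at hk
  | true :: m, 0, k', _, _ => by simp
  | true :: m, k + 1, k', hk, hk' => by
      have hk0 : k < m.count true := by simpa using hk
      have hk'0 : k' < m.count false := by simpa using hk'
      simpa using tpos_ne_fpos m hk0 hk'0
  | false :: m, k, 0, _, _ => by simp
  | false :: m, k, k' + 1, hk, hk' => by
      have hk0 : k < m.count true := by simpa using hk
      have hk'0 : k' < m.count false := by simpa using hk'
      simpa using tpos_ne_fpos m hk0 hk'0

/-! ### Finite-difference operators on functions of sequences -/

variable {Λ : Type*} [AddCommGroup Λ] {ι : Type*} {S : Type*}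

/-- Shift the lattice point of the `k`-th entry of a sequence `z ∈ (Λ × ι)^*` by `s`. [folklore] -/
def shiftAt (k : ℕ) (s : Λ) (z : List (Λ × ι)) : List (Λ × ι) := z.modify k fun p => (p.1 + s, p.2)

/-- Shifting an entry preserves the length. [folklore] -/
@[simp] theorem length_shiftAt (k : ℕ) (s : Λ) (z : List (Λ × ι)) : (shiftAt k s z).length = z.length :=
  List.length_modify ..

/-- The finite-difference operator `∇^s` acting on the `k`-th argument of a function of sequences:
`(∇^s_{z_k} g)_z = g_{z_1,…,z_k + s,…} - g_z` ("`∇^e f_x = f_{x+e} - f_x`", and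
`(∇^α g)_z = ∇^{α_1}_{z_1} ⋯ ∇^{α_r}_{z_r} g_{z_1,…,z_r}`).
[cite: BrydgesSlade2015RGI, §3.3 (displays defining ∇^e and ∇^α)] -/
def diffOp {M : Type*} [AddCommGroup M] (k : ℕ) (s : Λ) (g : List (Λ × ι) → M) :
    List (Λ × ι) → M :=
  fun z => g (shiftAt k s z) - g z

variable (step : S → Λ)

/-- `∇^α` for a derivative programme `α`: a list of (argument position, unit direction) pairs,
the multi-index `α_k` of [BS-rg-norm] being the multiset of directions listed at position `k`.
[folklore] -/
def napply {M : Type*} [AddCommGroup M] (α : List (ℕ × S)) (g : List (Λ × ι) → M) :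
    List (Λ × ι) → M :=
  α.foldr (fun q h => diffOp q.1 (step q.2) h) g

/-- `∇^∅ = id`. [folklore] -/
@[simp] theorem napply_nil {M : Type*} [AddCommGroup M] (g : List (Λ × ι) → M) :
    napply step [] g = g := rfl

/-- `∇^{(k,s)·α} = ∇^s_{z_k} ∘ ∇^α`. [folklore] -/
@[simp] theorem napply_cons {M : Type*} [AddCommGroup M] (q : ℕ × S) (α : List (ℕ × S))
    (g : List (Λ × ι) → M) : napply step (q :: α) g = diffOp q.1 (step q.2) (napply step α g) := rfl

/-- `∇^{α∘β} = ∇^α ∘ ∇^β`. [folklore] -/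
theorem napply_append {M : Type*} [AddCommGroup M] (α β : List (ℕ × S)) (g : List (Λ × ι) → M) :
    napply step (α ++ β) g = napply step α (napply step β g) := by
  simp [napply, List.foldr_append]

/-- `∇^α` is additive. [folklore] -/
theorem napply_add {M : Type*} [AddCommGroup M] : ∀ (α : List (ℕ × S)) (g g' : List (Λ × ι) → M),
    napply step α (g + g') = napply step α g + napply step α g'
  | [], g, g' => rfl
  | q :: α, g, g' => by
      rw [napply_cons, napply_cons, napply_cons, napply_add α g g']
      funext z
      simp only [diffOp, Pi.add_apply]
      abel

/-- `∇^α` commutes with subtraction. [folklore] -/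
theorem napply_sub {M : Type*} [AddCommGroup M] : ∀ (α : List (ℕ × S)) (g g' : List (Λ × ι) → M),
    napply step α (g - g') = napply step α g - napply step α g'
  | [], g, g' => rfl
  | q :: α, g, g' => by
      rw [napply_cons, napply_cons, napply_cons, napply_sub α g g']
      funext z
      simp only [diffOp, Pi.sub_apply]
      abel

/-- `∇^α` is homogeneous. [folklore] -/
theorem napply_smul : ∀ (α : List (ℕ × S)) (c : ℝ) (g : List (Λ × ι) → ℝ),
    napply step α (c • g) = c • napply step α g
  | [], c, g => rfl
  | q :: α, c, g => by
      rw [napply_cons, napply_cons, napply_smul α c g]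
      funext z
      simp only [diffOp, Pi.smul_apply, smul_eq_mul]
      ring

/-- `∇^α 0 = 0`. [folklore] -/
theorem napply_zero {M : Type*} [AddCommGroup M] : ∀ α : List (ℕ × S),
    napply step α (0 : List (Λ × ι) → M) = 0
  | [] => rfl
  | q :: α => by
      rw [napply_cons, napply_zero α]
      funext z
      simp [diffOp]

/-- Locality: `(∇^α g)_z` depends only on the values of `g` on sequences of length `|z|`.
[folklore] -/
theorem napply_congr {M : Type*} [AddCommGroup M] :
    ∀ (α : List (ℕ × S)) {g g' : List (Λ × ι) → M} {r : ℕ},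
      (∀ w, w.length = r → g w = g' w) → ∀ z, z.length = r → napply step α g z = napply step α g' z
  | [], g, g', r, h, z, hz => h z hz
  | q :: α, g, g', r, h, z, hz => by
      simp only [napply_cons, diffOp]
      rw [napply_congr α h z hz, napply_congr α h (shiftAt q.1 (step q.2) z) (by simp [hz])]

/-! ### Derivative programmes: relabelling, admissibility -/

/-- Relabel the argument positions of a programme. [folklore] -/
def relabel (f : ℕ → ℕ) (α : List (ℕ × S)) : List (ℕ × S) := α.map fun q => (f q.1, q.2)

/-- Relabelling the empty programme. [folklore] -/
@[simp] theorem relabel_nil (f : ℕ → ℕ) : relabel (S := S) f [] = [] := rfl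
/-- Relabelling acts entrywise. [folklore] -/
@[simp] theorem relabel_cons (f : ℕ → ℕ) (q : ℕ × S) (α : List (ℕ × S)) :
    relabel f (q :: α) = (f q.1, q.2) :: relabel f α := rfl
/-- Relabelling preserves the number of differences `|α|`. [folklore] -/
@[simp] theorem length_relabel (f : ℕ → ℕ) (α : List (ℕ × S)) : (relabel f α).length = α.length := by
  simp [relabel]

/-- Number of finite differences a programme applies to argument `p` (`|α_p|₁`). [folklore] -/
def countAt (p : ℕ) (α : List (ℕ × S)) : ℕ := (α.map Prod.fst).count p

/-- Admissible programmes for sequences of length `r`: every position is `< r`, and at most `p_Φ`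
differences act on each argument ("`|α_k|₁ ≤ p_Φ` for each component `α_k`").
[cite: BrydgesSlade2015RGI, Example 3.3.2] -/
def Adm (pΦ r : ℕ) (α : List (ℕ × S)) : Prop :=
  (∀ q ∈ α, q.1 < r) ∧ ∀ p, countAt p α ≤ pΦ

/-- The empty programme is admissible. [folklore] -/
theorem adm_nil (pΦ r : ℕ) : Adm pΦ r ([] : List (ℕ × S)) := ⟨fun _ h => by simp at h, fun _ => by simp [countAt]⟩

/-- `|·|_1` at a position is additive under concatenation of programmes. [folklore] -/
theorem countAt_append (p : ℕ) (α β : List (ℕ × S)) : countAt p (α ++ β) = countAt p α + countAt p β := by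
  simp [countAt, List.count_append]

/-- The positions of a relabelled programme. [folklore] -/
theorem map_fst_relabel (f : ℕ → ℕ) (α : List (ℕ × S)) :
    (relabel f α).map Prod.fst = (α.map Prod.fst).map f := by
  simp [relabel, List.map_map, Function.comp_def]

/-- Relabelling by an injective map keeps `|α_k|_1 ≤ p_Φ`. [folklore] -/
theorem countAt_relabel_le {pΦ r : ℕ} {α : List (ℕ × S)} (hα : Adm pΦ r α) {f : ℕ → ℕ}
    (hf : Function.Injective f) (p : ℕ) : countAt p (relabel f α) ≤ pΦ := by
  unfold countAt
  rw [map_fst_relabel]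
  by_cases hp : ∃ k ∈ α.map Prod.fst, f k = p
  · obtain ⟨k₀, _, rfl⟩ := hp
    rw [List.count_map_of_injective _ _ hf]
    exact hα.2 _
  · push Not at hp
    rw [List.count_eq_zero.2]
    · exact Nat.zero_le _
    · intro h
      rw [List.mem_map] at h
      obtain ⟨k, hk, hkp⟩ := h
      exact hp k hk hkp

/-- A position not in the image of the relabelling carries no difference. [folklore] -/
theorem countAt_relabel_eq_zero {α : List (ℕ × S)} {f : ℕ → ℕ} {p : ℕ} (h : ∀ q ∈ α, f q.1 ≠ p) :
    countAt p (relabel f α) = 0 := by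
  unfold countAt
  rw [map_fst_relabel, List.count_eq_zero]
  intro hp
  rw [List.mem_map] at hp
  obtain ⟨k, hk, hkp⟩ := hp
  rw [List.mem_map] at hk
  obtain ⟨q, hq, rfl⟩ := hk
  exact h q hq hkp

/-- The programme obtained by transporting `α` (acting on `z'`) and `α'` (acting on `z''`) to an
interleaving `z ∈ z' ◇ z''` ("the derivatives within the `λ` factors act on the arguments of `g_z`
according to their permuted locations within `z`"). [cite: BrydgesSlade2015RGI, §5.1 (end of the proof of Proposition 5.1.2)] -/
def mergeProg (m : List Bool) (α α' : List (ℕ × S)) : List (ℕ × S) :=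
  relabel (fpos m) α' ++ relabel (tpos m) α

/-- The transported programme has `|α| + |α'|` differences. [folklore] -/
theorem length_mergeProg (m : List Bool) (α α' : List (ℕ × S)) :
    (mergeProg m α α').length = α.length + α'.length := by
  simp [mergeProg]; omega

/-- The programme transported to an interleaving of `z'` and `z''` is admissible for the merged
sequence (positions relocated injectively and disjointly by `tpos`, `fpos`). [cite:
BrydgesSlade2015RGI, §5.1 (end of the proof of Proposition 5.1.2)] -/
theorem adm_mergeProg {pΦ r r' : ℕ} {α α' : List (ℕ × S)} (hα : Adm pΦ r α) (hα' : Adm pΦ r' α')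
    {m : List Bool} (hm : m ∈ masks r r') : Adm pΦ (r + r') (mergeProg m α α') := by
  obtain ⟨hct, hcf⟩ := count_of_mem_masks hm
  have hlen : m.length = r + r' := by rw [← List.count_true_add_count_false m, hct, hcf]
  constructor
  · intro q hq
    simp only [mergeProg, List.mem_append, relabel, List.mem_map] at hq
    rcases hq with ⟨q', hq', rfl⟩ | ⟨q', hq', rfl⟩
    · simpa [hlen] using fpos_lt m q'.1 (hcf ▸ hα'.1 q' hq')
    · simpa [hlen] using tpos_lt m q'.1 (hct ▸ hα.1 q' hq')
  · intro p
    rw [mergeProg, countAt_append]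
    by_cases h1 : ∃ q ∈ α', fpos m q.1 = p
    · obtain ⟨q₁, hq₁, hq₁p⟩ := h1
      have h2 : ∀ q ∈ α, tpos m q.1 ≠ p := by
        intro q hq heq
        exact tpos_ne_fpos m (hct ▸ hα.1 q hq) (hcf ▸ hα'.1 q₁ hq₁) (heq.trans hq₁p.symm)
      rw [countAt_relabel_eq_zero h2, add_zero]
      exact countAt_relabel_le hα' (fun k k' h => fpos_injective m h) p
    · push Not at h1
      rw [countAt_relabel_eq_zero h1, zero_add]
      exact countAt_relabel_le hα (fun k k' h => tpos_injective m h) p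

/-! ### Shuffle averages of mask-indexed families, and how `∇` acts on them -/

/-- `S_G(u,v)`: the average over the interleavings `m` of `G_m` at `merge m u v` (for a constant
family `G_m = g` this is the shuffle average `f_{u,v}` of `g`). [folklore] -/
def maskAvg (G : List Bool → List (Λ × ι) → ℝ) (u v : List (Λ × ι)) : ℝ :=
  ((masks u.length v.length).map fun m => G m (merge m u v)).sum /
    ((u.length + v.length).choose u.length : ℕ)

omit [AddCommGroup Λ] in
/-- The shuffle average is the mask average of a constant family. [folklore] -/
theorem shAvg_eq_maskAvg (g : List (Λ × ι) → ℝ) (u v : List (Λ × ι)) :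
    shAvg g u v = maskAvg (fun _ => g) u v := rfl

/-- `Σ_b (f b - f' b) = Σ_b f b - Σ_b f' b` for list sums. [folklore] -/
theorem list_sum_map_sub {β : Type*} (l : List β) (f f' : β → ℝ) :
    (l.map fun b => f b - f' b).sum = (l.map f).sum - (l.map f').sum := by
  induction l with
  | nil => simp
  | cons b l ih => simp only [List.map_cons, List.sum_cons, ih]; ring

omit [AddCommGroup Λ] in
/-- The mask average is linear (subtraction). [folklore] -/
theorem maskAvg_sub (G G' : List Bool → List (Λ × ι) → ℝ) (u v : List (Λ × ι)) :
    maskAvg (fun m w => G m w - G' m w) u v = maskAvg G u v - maskAvg G' u v := by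
  simp only [maskAvg]
  rw [list_sum_map_sub, sub_div]

omit [AddCommGroup Λ] in
/-- A uniform bound over the interleavings bounds the mask average. [folklore] -/
theorem abs_maskAvg_le {G : List Bool → List (Λ × ι) → ℝ} {u v : List (Λ × ι)} {C : ℝ}
    (h : ∀ m ∈ masks u.length v.length, |G m (merge m u v)| ≤ C) : |maskAvg G u v| ≤ C := by
  unfold maskAvg
  have hpos : (0 : ℝ) < ((u.length + v.length).choose u.length : ℕ) := by
    exact_mod_cast Nat.choose_pos (Nat.le_add_right _ _)
  rw [abs_div, abs_of_pos hpos, div_le_iff₀ hpos]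
  calc |((masks u.length v.length).map fun m => G m (merge m u v)).sum|
      ≤ ((masks u.length v.length).map fun m => |G m (merge m u v)|).sum := abs_sum_map_le _ _
    _ ≤ ((masks u.length v.length).map fun _ => C).sum := List.sum_le_sum (fun m hm => h m hm)
    _ = C * ((u.length + v.length).choose u.length : ℕ) := by
        rw [List.map_const', List.sum_replicate, length_masks, nsmul_eq_mul, mul_comm]

/-- **`∇` in the first variable of a shuffle average**:
`∇^α_u S_G(u,v)|_{u=z} = S_{G'}(z,v)` with `G'_m = ∇^{tpos_m α} G_m`. [folklore] -/
theorem napply_maskAvg_left (G : List Bool → List (Λ × ι) → ℝ) (v : List (Λ × ι)) :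
    ∀ (α : List (ℕ × S)) (z : List (Λ × ι)),
      napply step α (fun u => maskAvg G u v) z =
        maskAvg (fun m => napply step (relabel (tpos m) α) (G m)) z v
  | [], z => rfl
  | q :: α, z => by
      rw [napply_cons, diffOp, napply_maskAvg_left G v α, napply_maskAvg_left G v α]
      have h : maskAvg (fun m => napply step (relabel (tpos m) α) (G m)) (shiftAt q.1 (step q.2) z) v =
          maskAvg (fun m w => napply step (relabel (tpos m) α) (G m) (shiftAt (tpos m q.1) (step q.2) w))
            z v := by
        unfold maskAvg
        rw [length_shiftAt]
        congr 2
        refine List.map_congr_left fun m hm => ?_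
        obtain ⟨hct, hcf⟩ := count_of_mem_masks hm
        simp only [shiftAt]
        rw [merge_modify_left _ m q.1 z v hct hcf]
      rw [h, ← maskAvg_sub]
      rfl

/-- **`∇` in the second variable of a shuffle average**:
`∇^{α'}_v S_G(u,v)|_{v=z'} = S_{G'}(u,z')` with `G'_m = ∇^{fpos_m α'} G_m`. [folklore] -/
theorem napply_maskAvg_right (G : List Bool → List (Λ × ι) → ℝ) (u : List (Λ × ι)) :
    ∀ (α : List (ℕ × S)) (z : List (Λ × ι)),
      napply step α (fun v => maskAvg G u v) z =
        maskAvg (fun m => napply step (relabel (fpos m) α) (G m)) u z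
  | [], z => rfl
  | q :: α, z => by
      rw [napply_cons, diffOp, napply_maskAvg_right G u α, napply_maskAvg_right G u α]
      have h : maskAvg (fun m => napply step (relabel (fpos m) α) (G m)) u (shiftAt q.1 (step q.2) z) =
          maskAvg (fun m w => napply step (relabel (fpos m) α) (G m) (shiftAt (fpos m q.1) (step q.2) w))
            u z := by
        unfold maskAvg
        rw [length_shiftAt]
        congr 2
        refine List.map_congr_left fun m hm => ?_
        obtain ⟨hct, hcf⟩ := count_of_mem_masks hm
        simp only [shiftAt]
        rw [merge_modify_right _ m q.1 u z hct hcf]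
      rw [h, ← maskAvg_sub]
      rfl


/-! ### The lattice test functionals `λ_{α,z} = 𝔥^{-|z|} R^{|α|} ∇^α (·)_z` and the norm `Φ(𝔥)` -/

/-- The test functional `g ↦ 𝔥^{-|z|} R^{|α|} (∇^α g)_z` (`λ_{α,z} = w_{α,z}^{-1}∇^α`, weights of
Example 3.3.2 of [BS-rg-norm]: `w^{-1}_{α_k,z_k} = 𝔥^{-1}R^{|α_k|_1}`; in Slade (6.28) `R = L^j`,
`𝔥 = 𝔥_j`). [cite: BrydgesSlade2015RGI, Definition 3.3.1 and Example 3.3.2] [cite: Slade2017, §6.2.1 (display (6.28))] -/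
def latticeFun (𝔥 R : ℝ) (α : List (ℕ × S)) (z : List (Λ × ι)) : TestFunctional (Λ × ι) where
  len := z.length
  toFun :=
    { toFun := fun g => (𝔥 ^ z.length)⁻¹ * R ^ α.length * napply step α g z
      map_add' := fun g g' => by
        rw [napply_add, Pi.add_apply]; ring
      map_smul' := fun c g => by
        rw [napply_smul, Pi.smul_apply, smul_eq_mul, RingHom.id_apply, smul_eq_mul]; ring }
  local' := fun g g' h => by
    show (𝔥 ^ z.length)⁻¹ * R ^ α.length * napply step α g z =
      (𝔥 ^ z.length)⁻¹ * R ^ α.length * napply step α g' z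
    rw [napply_congr step α h z rfl]

/-- The value `𝔥^{-|z|}R^{|α|}(∇^αg)_z` of the lattice functional. [folklore] -/
theorem latticeFun_apply (𝔥 R : ℝ) (α : List (ℕ × S)) (z : List (Λ × ι)) (g : List (Λ × ι) → ℝ) :
    (latticeFun step 𝔥 R α z).toFun g = (𝔥 ^ z.length)⁻¹ * R ^ α.length * napply step α g z := rfl

/-- **The family of test functionals defining the norm `Φ(𝔥)` / `Φ_j(𝔥_j)`**: all `λ_{α,z}` with
`α` admissible for `z` (`|α_k|_1 ≤ p_Φ` per argument). Its unit ball `B(Φ)` consists of the test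
functions with `|∇^α g_z| ≤ 𝔥^{|z|} R^{-|α|}` (display (tfe) of [BS-rg-norm]), vanishing on
sequences longer than `p_𝒩`. [cite: BrydgesSlade2015RGI, Definition 3.3.1, Example 3.3.2 (display (tfe))] [cite: Slade2017, §6.2.1 (display (6.28))] -/
def latticeFamily (𝔥 R : ℝ) (pΦ : ℕ) : Set (TestFunctional (Λ × ι)) :=
  {ℓ | ∃ (α : List (ℕ × S)) (z : List (Λ × ι)), Adm pΦ z.length α ∧ ℓ = latticeFun step 𝔥 R α z}

/-- Admissible `λ_{α,z}` belong to the family. [folklore] -/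
theorem latticeFun_mem (𝔥 R : ℝ) {pΦ : ℕ} {α : List (ℕ × S)} {z : List (Λ × ι)}
    (hα : Adm pΦ z.length α) : latticeFun step 𝔥 R α z ∈ latticeFamily step 𝔥 R pΦ :=
  ⟨α, z, hα, rfl⟩

/-- In the unit ball of `Φ(𝔥)`: `|∇^α g_z| ≤ 𝔥^{|z|} R^{-|α|}` for admissible `α`
("test functions in the unit ball `B(Φ)` are those which obey the estimate `|∇^α g_z| ≤ 𝔥^z R^{-α}`").
[cite: BrydgesSlade2015RGI, Example 3.3.2 (display (tfe))] -/
theorem abs_napply_le_of_mem_ball [Fintype Λ] [Fintype ι] {𝔥 R : ℝ} (h𝔥 : 0 < 𝔥) (hR : 0 < R)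
    {pΦ pN : ℕ} {g : List (Λ × ι) → ℝ} (hg : g ∈ ball pN (latticeFamily step 𝔥 R pΦ))
    {α : List (ℕ × S)} {z : List (Λ × ι)} (hα : Adm pΦ z.length α) :
    |napply step α g z| ≤ 𝔥 ^ z.length * (R ^ α.length)⁻¹ := by
  have h := hg.2 _ (latticeFun_mem step 𝔥 R hα)
  rw [latticeFun_apply, abs_mul, abs_mul, abs_inv, abs_of_pos (pow_pos h𝔥 _),
    abs_of_pos (pow_pos hR _)] at h
  have h1 : 0 < 𝔥 ^ z.length := pow_pos h𝔥 _
  have h2 : 0 < R ^ α.length := pow_pos hR _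
  rw [mul_assoc, inv_mul_le_iff₀ h1, mul_one] at h
  rwa [le_mul_inv_iff₀ h2, mul_comm]

/-- The unit ball of `Φ(𝔥)` is bounded on sequences of each length: `|g_z| ≤ 𝔥^{|z|}`. [folklore] -/
theorem latticeFamily_evalBound [Fintype Λ] [Fintype ι] {𝔥 R : ℝ} (h𝔥 : 0 < 𝔥) (hR : 0 < R)
    (pΦ pN : ℕ) : EvalBound (Ξ := Λ × ι) pN (latticeFamily step 𝔥 R pΦ) (fun r => 𝔥 ^ r) := by
  intro g hg z _
  have := abs_napply_le_of_mem_ball step h𝔥 hR hg (adm_nil pΦ z.length)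
  simpa using this

/-- The indicator of the empty sequence is in the unit ball of `Φ(𝔥)`. [folklore] -/
theorem indicator_nil_mem_ball [Fintype Λ] [Fintype ι] (𝔥 R : ℝ) (pΦ pN : ℕ) :
    (fun z : List (Λ × ι) => if z = [] then (1 : ℝ) else 0) ∈ ball pN (latticeFamily step 𝔥 R pΦ) := by
  refine ⟨fun z hz => ?_, ?_⟩
  · have : z ≠ [] := by rintro rfl; simp at hz
    simp [this]
  · rintro _ ⟨α, z, hα, rfl⟩
    rw [latticeFun_apply]
    cases z with
    | nil =>
      have hαnil : α = [] := by
        cases α with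
        | nil => rfl
        | cons q α => exact absurd (hα.1 q (by simp)) (by simp)
      subst hαnil
      simp
    | cons a z =>
      rw [napply_congr step α (g' := fun _ => 0) (r := (a :: z).length) _ _ rfl]
      · rw [show (fun _ : List (Λ × ι) => (0 : ℝ)) = 0 from rfl, napply_zero]
        simp
      · intro w hw
        have : w ≠ [] := by rintro rfl; simp at hw
        simp [this]

/-- **The lattice norms `Φ(𝔥)` have the shuffle property** — the last step of the proof of
Proposition 5.1.2 of [BS-rg-norm] ("`|λ_{α'',z''} λ_{α',z'} f_{z',z''}| ≤ 1` … it suffices to show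
that, for each `z ∈ z'◇z''`, `|λ_{α'',z''}λ_{α',z'} g_z| ≤ 1`, where the derivatives within the `λ`
factors act on the arguments of `g_z` according to their permuted locations within `z`. Since this
is a consequence of `g ∈ B(Φ)` and the definition of the `Φ` norm, this completes the proof"),
here carried out with the interleavings as masks: `∇` in either variable of the shuffle average is
the shuffle average of the transported `∇`'s (`napply_maskAvg_left/right`), the transported
programme is admissible for the merged sequence (`adm_mergeProg`), and the weights multiply.
[cite: BrydgesSlade2015RGI, §5.1 (proof of Proposition 5.1.2, displays (lamlam1)–(lam1))] -/
theorem latticeFamily_shuffleCompat [Fintype Λ] [Fintype ι] {𝔥 R : ℝ} (h𝔥 : 0 < 𝔥) (hR : 0 < R)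
    (pΦ pN : ℕ) : ShuffleCompat (Ξ := Λ × ι) pN (latticeFamily step 𝔥 R pΦ) := by
  rintro g hg _ ⟨α, z, hα, rfl⟩ _ ⟨α', z', hα', rfl⟩
  rw [latticeFun_apply]
  -- the inner functional, as a function of the second variable
  have hin : (fun v => (latticeFun step 𝔥 R α z).toFun (fun u => shAvg g u v)) =
      (((𝔥 ^ z.length)⁻¹ * R ^ α.length) : ℝ) •
        fun v => maskAvg (fun m => napply step (relabel (tpos m) α) g) z v := by
    funext v
    rw [latticeFun_apply, Pi.smul_apply, smul_eq_mul]
    congr 1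
    exact napply_maskAvg_left step (fun _ => g) v α z
  rw [hin, napply_smul, Pi.smul_apply, smul_eq_mul, napply_maskAvg_right]
  -- each interleaving contributes at most `𝔥^{|z|+|z'|} R^{-(|α|+|α'|)}`
  have hbd : |maskAvg (fun m => napply step (relabel (fpos m) α')
      (napply step (relabel (tpos m) α) g)) z z'| ≤
      𝔥 ^ (z.length + z'.length) * (R ^ (α.length + α'.length))⁻¹ := by
    refine abs_maskAvg_le fun m hm => ?_
    rw [← napply_append]
    have hadm : Adm pΦ (merge m z z').length (mergeProg m α α') := by
      rw [length_merge_of_mem_masks hm rfl rfl]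
      exact adm_mergeProg hα hα' hm
    have := abs_napply_le_of_mem_ball step h𝔥 hR hg hadm
    rwa [length_merge_of_mem_masks hm rfl rfl, length_mergeProg] at this
  have h1 : 0 < 𝔥 ^ z.length := pow_pos h𝔥 _
  have h2 : 0 < 𝔥 ^ z'.length := pow_pos h𝔥 _
  have h3 : 0 < R ^ α.length := pow_pos hR _
  have h4 : 0 < R ^ α'.length := pow_pos hR _
  rw [abs_mul, abs_mul, abs_mul, abs_mul, abs_inv, abs_inv, abs_of_pos h1, abs_of_pos h2,
    abs_of_pos h3, abs_of_pos h4]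
  rw [pow_add, pow_add, mul_inv] at hbd
  calc (𝔥 ^ z'.length)⁻¹ * R ^ α'.length * ((𝔥 ^ z.length)⁻¹ * R ^ α.length *
        |maskAvg (fun m => napply step (relabel (fpos m) α')
          (napply step (relabel (tpos m) α) g)) z z'|)
      ≤ (𝔥 ^ z'.length)⁻¹ * R ^ α'.length * ((𝔥 ^ z.length)⁻¹ * R ^ α.length *
        (𝔥 ^ z.length * 𝔥 ^ z'.length * ((R ^ α.length)⁻¹ * (R ^ α'.length)⁻¹))) := by
        gcongr
    _ = 1 := by field_simp

/-! ### Products of test functions in separate variables: `‖g' ⊗ g''‖_Φ ≤ ‖g'‖_Φ ‖g''‖_Φ` -/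

/-- Modifying an entry of `u ∘ v` inside `u` acts on `u`. [folklore] -/
theorem modify_append_of_lt {α : Type*} (f : α → α) : ∀ (k : ℕ) (u v : List α),
    k < u.length → (u ++ v).modify k f = u.modify k f ++ v
  | k, [], v, hk => by simp at hk
  | 0, a :: u, v, _ => by simp
  | k + 1, a :: u, v, hk => by
      simp only [List.cons_append, List.modify_succ_cons, List.cons.injEq, true_and]
      exact modify_append_of_lt f k u v (by simpa using hk)

/-- Modifying an entry of `u ∘ v` beyond `u` acts on `v`. [folklore] -/
theorem modify_append_of_le {α : Type*} (f : α → α) : ∀ (k : ℕ) (u v : List α),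
    u.length ≤ k → (u ++ v).modify k f = u ++ v.modify (k - u.length) f
  | k, [], v, _ => by simp
  | 0, a :: u, v, hk => by simp at hk
  | k + 1, a :: u, v, hk => by
      simp only [List.cons_append, List.modify_succ_cons, List.length_cons, Nat.reduceSubDiff,
        List.cons.injEq, true_and]
      exact modify_append_of_le f k u v (by simpa using hk)

/-- The part of a programme acting on the first `r` arguments. [folklore] -/
def progLeft (r : ℕ) (β : List (ℕ × S)) : List (ℕ × S) := β.filter fun q => q.1 < r

/-- The part of a programme acting on the arguments after the first `r`, relabelled from `0`.
[folklore] -/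
def progRight (r : ℕ) (β : List (ℕ × S)) : List (ℕ × S) :=
  relabel (fun k => k - r) (β.filter fun q => r ≤ q.1)

/-- `|α| = |α_{<r}| + |α_{≥r}|`. [folklore] -/
theorem length_progLeft_add (r : ℕ) (β : List (ℕ × S)) :
    (progLeft r β).length + (progRight r β).length = β.length := by
  simp only [progLeft, progRight, length_relabel]
  induction β with
  | nil => simp
  | cons q β ih =>
    by_cases h : q.1 < r
    · have h' : ¬ r ≤ q.1 := Nat.not_le.2 h
      simp [h, h']; omega
    · have h' : r ≤ q.1 := Nat.not_lt.1 h
      simp [h, h']; omega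

/-- **`∇` on a product of test functions of disjoint sets of arguments factorises.** [folklore] -/
theorem napply_prod (g' g'' : List (Λ × ι) → ℝ) (r : ℕ) : ∀ (β : List (ℕ × S)) (u v : List (Λ × ι)),
    u.length = r →
      napply step β (fun w => g' (w.take r) * g'' (w.drop r)) (u ++ v) =
        napply step (progLeft r β) g' u * napply step (progRight r β) g'' v
  | [], u, v, hu => by simp [progLeft, progRight, relabel, ← hu]
  | q :: β, u, v, hu => by
      rw [napply_cons, diffOp]
      by_cases hk : q.1 < r
      · have hk' : ¬ r ≤ q.1 := Nat.not_le.2 hk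
        have hL : progLeft r (q :: β) = q :: progLeft r β := by simp [progLeft, hk]
        have hR : progRight r (q :: β) = progRight r β := by simp [progRight, hk']
        have hsh : shiftAt q.1 (step q.2) (u ++ v) = shiftAt q.1 (step q.2) u ++ v :=
          modify_append_of_lt _ _ _ _ (by omega)
        rw [hsh, napply_prod g' g'' r β _ v (by simp [hu]), napply_prod g' g'' r β u v hu, hL, hR,
          napply_cons, diffOp]
        ring
      · have hk' : r ≤ q.1 := Nat.not_lt.1 hk
        have hL : progLeft r (q :: β) = progLeft r β := by simp [progLeft, hk]
        have hR : progRight r (q :: β) = (q.1 - r, q.2) :: progRight r β := by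
          simp [progRight, hk']
        have hsh : shiftAt q.1 (step q.2) (u ++ v) = u ++ shiftAt (q.1 - r) (step q.2) v := by
          have := modify_append_of_le (fun p : Λ × ι => (p.1 + step q.2, p.2)) q.1 u v (by omega)
          simpa [shiftAt, hu] using this
        rw [hsh, napply_prod g' g'' r β u _ hu, napply_prod g' g'' r β u v hu, hL, hR, napply_cons,
          diffOp]
        ring

/-- The part of an admissible programme acting on the first `r` arguments is admissible for length
`r`. [folklore] -/
theorem adm_progLeft {pΦ r r' : ℕ} {β : List (ℕ × S)} (hβ : Adm pΦ (r + r') β) :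
    Adm pΦ r (progLeft r β) := by
  refine ⟨fun q hq => ?_, fun p => le_trans ?_ (hβ.2 p)⟩
  · have := (List.mem_filter.1 hq).2
    simpa using this
  · unfold countAt progLeft
    exact (List.filter_sublist.map Prod.fst).count_le _

/-- The part of an admissible programme acting beyond the first `r` arguments is admissible for the
remaining length. [folklore] -/
theorem adm_progRight {pΦ r r' : ℕ} {β : List (ℕ × S)} (hβ : Adm pΦ (r + r') β) :
    Adm pΦ r' (progRight r β) := by
  constructor
  · intro q hq
    simp only [progRight, relabel, List.mem_map, List.mem_filter, decide_eq_true_eq] at hq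
    obtain ⟨q', ⟨hq', hle⟩, rfl⟩ := hq
    have := hβ.1 q' hq'
    dsimp only
    omega
  · intro p
    refine le_trans ?_ (hβ.2 (p + r))
    unfold countAt progRight
    rw [map_fst_relabel, List.count_eq_countP, List.countP_map, List.count_eq_countP]
    calc List.countP ((fun x => x == p) ∘ fun k => k - r)
          ((List.filter (fun q : ℕ × S => r ≤ q.1) β).map Prod.fst)
        = List.countP (fun x => x == p + r) ((List.filter (fun q : ℕ × S => r ≤ q.1) β).map Prod.fst) := by
          refine List.countP_congr fun k hk => ?_
          simp only [List.mem_map, List.mem_filter, decide_eq_true_eq] at hk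
          obtain ⟨q, ⟨_, hq⟩, rfl⟩ := hk
          simp only [Function.comp_apply, beq_iff_eq]
          omega
      _ ≤ List.countP (fun x => x == p + r) (β.map Prod.fst) :=
          (List.filter_sublist.map Prod.fst).countP_le

/-- The product `(g' ⊗ g'')_w = g'_{w'} g''_{w''}` for `w = w' ∘ w''`, `|w'| = r`, `|w''| = r'`, of
test functions in separate variables (zero on sequences of other lengths). [folklore] -/
def prodFn (r r' : ℕ) (g' g'' : List (Λ × ι) → ℝ) : List (Λ × ι) → ℝ :=
  fun w => if w.length = r + r' then g' (w.take r) * g'' (w.drop r) else 0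

/-- **`‖g' ⊗ g''‖_Φ ≤ ‖g'‖_{Φ^{(r)}} ‖g''‖_{Φ^{(r')}}`** for the lattice norms (display (gprodbd) of
[BS-rg-norm]: "it follows from the definition of the norm"): if `|∇^β g'_u| ≤ c' 𝔥^r R^{-|β|}`
for `|u| = r` and `|∇^β g''_v| ≤ c'' 𝔥^{r'} R^{-|β|}` for `|v| = r'` (admissible `β`), then every
lattice test functional is at most `c'c''` on `g' ⊗ g''`.
[cite: BrydgesSlade2015RGI, §3.3 (display ‖g‖_Φ ≤ ‖g'‖_{Φ^{(r)}}‖g''‖_Φ)] -/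
theorem prodFn_polar {𝔥 R : ℝ} (h𝔥 : 0 < 𝔥) (hR : 0 < R) {pΦ r r' : ℕ}
    {g' g'' : List (Λ × ι) → ℝ} {c' c'' : ℝ} (hc' : 0 ≤ c') (hc'' : 0 ≤ c'')
    (H' : ∀ u : List (Λ × ι), u.length = r → ∀ β : List (ℕ × S), Adm pΦ r β →
      |napply step β g' u| ≤ c' * 𝔥 ^ r * (R ^ β.length)⁻¹)
    (H'' : ∀ v : List (Λ × ι), v.length = r' → ∀ β : List (ℕ × S), Adm pΦ r' β →
      |napply step β g'' v| ≤ c'' * 𝔥 ^ r' * (R ^ β.length)⁻¹) :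
    ∀ ℓ ∈ latticeFamily step 𝔥 R pΦ, |ℓ.toFun (prodFn r r' g' g'')| ≤ c' * c'' := by
  rintro _ ⟨β, w, hβ, rfl⟩
  rw [latticeFun_apply]
  by_cases hw : w.length = r + r'
  · -- split `w = u ∘ v`
    have hu : (w.take r).length = r := by simp [hw]
    have hv : (w.drop r).length = r' := by simp [hw]
    have hnap : napply step β (prodFn r r' g' g'') w =
        napply step (progLeft r β) g' (w.take r) * napply step (progRight r β) g'' (w.drop r) := by
      rw [← napply_prod step g' g'' r β (w.take r) (w.drop r) hu, List.take_append_drop]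
      refine napply_congr step β (fun w' hw' => ?_) w rfl
      simp [prodFn, hw', hw]
    rw [hw] at hβ
    have h1 := H' _ hu _ (adm_progLeft hβ)
    have h2 := H'' _ hv _ (adm_progRight hβ)
    have hlen := length_progLeft_add r β
    have hRpow : R ^ β.length = R ^ (progLeft r β).length * R ^ (progRight r β).length := by
      rw [← pow_add, hlen]
    rw [hnap, hw, hRpow, abs_mul, abs_mul, abs_mul, abs_mul, abs_inv, abs_of_pos (pow_pos h𝔥 _),
      abs_of_pos (pow_pos hR _), abs_of_pos (pow_pos hR _)]
    have hA : 0 < 𝔥 ^ (r + r') := pow_pos h𝔥 _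
    have hB : 0 < R ^ (progLeft r β).length := pow_pos hR _
    have hB' : 0 < R ^ (progRight r β).length := pow_pos hR _
    calc (𝔥 ^ (r + r'))⁻¹ * (R ^ (progLeft r β).length * R ^ (progRight r β).length) *
          (|napply step (progLeft r β) g' (List.take r w)| *
            |napply step (progRight r β) g'' (List.drop r w)|)
        ≤ (𝔥 ^ (r + r'))⁻¹ * (R ^ (progLeft r β).length * R ^ (progRight r β).length) *
          ((c' * 𝔥 ^ r * (R ^ (progLeft r β).length)⁻¹) *
            (c'' * 𝔥 ^ r' * (R ^ (progRight r β).length)⁻¹)) := by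
          gcongr
      _ = c' * c'' := by
          rw [pow_add]
          field_simp
  · rw [napply_congr step β (g' := fun _ => 0) (r := w.length) _ w rfl]
    · rw [show (fun _ : List (Λ × ι) => (0 : ℝ)) = 0 from rfl, napply_zero]
      simp only [Pi.zero_apply, mul_zero, abs_zero]
      exact mul_nonneg hc' hc''
    · intro w' hw'
      simp [prodFn, hw', hw]

omit [AddCommGroup Λ] in
/-- `g' ⊗ g''` vanishes on sequences of length `≠ r + r'`. [folklore] -/
theorem prodFn_eq_zero_of_length {r r' : ℕ} (g' g'' : List (Λ × ι) → ℝ) {w : List (Λ × ι)}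
    (hw : w.length ≠ r + r') : prodFn r r' g' g'' w = 0 := by
  simp [prodFn, hw]

/-- A one-argument test function `f : 𝚲 → ℝ` (e.g. the field, or the constant test function `𝟙`)
viewed as a test function supported on sequences of length one. [folklore] -/
def liftFn (f : Λ × ι → ℝ) : List (Λ × ι) → ℝ
  | [x] => f x
  | _ => 0

omit [AddCommGroup Λ] in
/-- `liftFn f` on a one-letter sequence is `f`. [folklore] -/
@[simp] theorem liftFn_singleton (f : Λ × ι → ℝ) (x : Λ × ι) : liftFn f [x] = f x := rfl

omit [AddCommGroup Λ] in
/-- `(g' ⊗ g'')_{(a,b)} = g'_a g''_b`. [folklore] -/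
theorem prodFn_one_one (g' g'' : List (Λ × ι) → ℝ) (a b : Λ × ι) :
    prodFn 1 1 g' g'' [a, b] = g' [a] * g'' [b] := by
  simp [prodFn]

omit [AddCommGroup Λ] in
/-- The pairing with a product test function on sequences of length two:
`⟨F, g' ⊗ g''⟩ = ½ Σ_{a,b} F_{(a,b)} g'_a g''_b`. [folklore] -/
theorem pairing_prodFn_one_one [Fintype Λ] [Fintype ι] {pN : ℕ} (hpN : 2 ≤ pN)
    (F g' g'' : List (Λ × ι) → ℝ) :
    pairing pN F (prodFn 1 1 g' g'') = 2⁻¹ * ∑ a : Λ × ι, ∑ b : Λ × ι, F [a, b] * (g' [a] * g'' [b]) := by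
  unfold pairing
  rw [Finset.sum_eq_single 2]
  · simp [sumSeq_succ, Nat.factorial, prodFn_one_one]
  · intro r _ hr
    rw [sumSeq_congr r (g := fun _ => 0), sumSeq_zero_fun, mul_zero]
    intro z hz
    rw [prodFn_eq_zero_of_length _ _ (by omega), mul_zero]
  · intro h
    exact absurd (Finset.mem_range.2 (by omega)) h

/-! ### Consequences for the `T_φ` seminorm of [BS-rg-norm] / Slade §6.2.2 -/

section consequences

variable [Fintype Λ] [Fintype ι]
variable {E : Type*} [NormedAddCommGroup E] [NormedSpace ℝ E]

open scoped ContDiff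

/-- **Product property of the `T_φ(𝔥)` seminorm for the lattice norms** (Brydges–Slade,
Proposition 3.4.5, for the test-function space `Φ(𝔥)` of Example 3.3.2 — the seminorm
`T_{φ,j}(𝔥_j)` of Slade (6.31) being the case `R = L^j`, `𝔥 = 𝔥_j`): for smooth `F, G`,
`‖FG‖_{T_φ(𝔥)} ≤ ‖F‖_{T_φ(𝔥)} ‖G‖_{T_φ(𝔥)}`.
[cite: BrydgesSlade2015RGI, Proposition 3.4.5 with Example 3.3.2] [cite: Slade2017, §6.2.2 (the T_{φ,j}(𝔥) seminorm, display (6.31))] -/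
theorem TphiNorm_mul_le_lattice {𝔥 R : ℝ} (h𝔥 : 0 < 𝔥) (hR : 0 < R) (pΦ pN : ℕ)
    (e : Λ × ι → E) {F G : E → ℝ} (hF : ContDiff ℝ ∞ F) (hG : ContDiff ℝ ∞ G) (φ : E) :
    TphiNorm pN (latticeFamily step 𝔥 R pΦ) e (fun ψ => F ψ * G ψ) φ ≤
      TphiNorm pN (latticeFamily step 𝔥 R pΦ) e F φ * TphiNorm pN (latticeFamily step 𝔥 R pΦ) e G φ :=
  TphiNorm_mul_le (latticeFamily_shuffleCompat step h𝔥 hR pΦ pN)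
    (latticeFamily_evalBound step h𝔥 hR pΦ pN) e hF hG φ

/-- `|F(φ)| ≤ ‖F‖_{T_φ(𝔥)}` ("`|F(0)| ≤ ‖F‖_{T_{0,N}}`" in the proof of Corollary 8.1.6 of Slade).
[cite: Slade2017, §8.1 (proof of Corollary 8.1.6)] [cite: BrydgesSlade2015RGI, §3.4] -/
theorem abs_apply_le_TphiNorm_lattice {𝔥 R : ℝ} (h𝔥 : 0 < 𝔥) (hR : 0 < R) (pΦ pN : ℕ)
    (e : Λ × ι → E) (F : E → ℝ) (φ : E) :
    |F φ| ≤ TphiNorm pN (latticeFamily step 𝔥 R pΦ) e F φ :=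
  abs_apply_le_TphiNorm (latticeFamily_evalBound step h𝔥 hR pΦ pN)
    (indicator_nil_mem_ball step 𝔥 R pΦ pN) e F φ

/-- Subadditivity of `T_φ(𝔥)` on smooth functions. [folklore] -/
theorem TphiNorm_add_le_lattice {𝔥 R : ℝ} (h𝔥 : 0 < 𝔥) (hR : 0 < R) (pΦ pN : ℕ)
    (e : Λ × ι → E) {F G : E → ℝ} (hF : ContDiff ℝ ∞ F) (hG : ContDiff ℝ ∞ G) (φ : E) :
    TphiNorm pN (latticeFamily step 𝔥 R pΦ) e (fun ψ => F ψ + G ψ) φ ≤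
      TphiNorm pN (latticeFamily step 𝔥 R pΦ) e F φ + TphiNorm pN (latticeFamily step 𝔥 R pΦ) e G φ :=
  TphiNorm_add_le (latticeFamily_evalBound step h𝔥 hR pΦ pN) e hF hG φ

/-- `|⟨F, g⟩_φ| ≤ ‖F‖_{T_φ(𝔥)}` on the unit ball of `Φ(𝔥)`. [folklore] -/
theorem abs_TphiPairing_le_lattice {𝔥 R : ℝ} (h𝔥 : 0 < 𝔥) (hR : 0 < R) (pΦ pN : ℕ)
    (e : Λ × ι → E) (F : E → ℝ) (φ : E) {g : List (Λ × ι) → ℝ}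
    (hg : g ∈ ball pN (latticeFamily step 𝔥 R pΦ)) :
    |TphiPairing pN e F φ g| ≤ TphiNorm pN (latticeFamily step 𝔥 R pΦ) e F φ :=
  abs_TphiPairing_le (latticeFamily_evalBound step h𝔥 hR pΦ pN) e F φ hg


omit [AddCommGroup Λ] in
/-- The second Fréchet derivative in a direction `v = Σ_x f_x e_x` in the span of the coordinate
directions, in terms of the coefficients: `D²F(φ; v, v) = Σ_{a,b} f_a f_b F_{(a,b)}(φ)`.
[folklore] -/
theorem iteratedFDeriv_two_apply_sum (e : Λ × ι → E) {F : E → ℝ} (hF : ContDiff ℝ ∞ F) (φ : E)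
    (f : Λ × ι → ℝ) :
    iteratedFDeriv ℝ 2 F φ (fun _ => ∑ x : Λ × ι, f x • e x) =
      ∑ a : Λ × ι, ∑ b : Λ × ι, f a * f b * coeff e [a, b] F φ := by
  classical
  rw [ContinuousMultilinearMap.map_sum (iteratedFDeriv ℝ 2 F φ) (fun _ x => f x • e x)]
  rw [← (finTwoArrowEquiv (Λ × ι)).symm.sum_comp, Fintype.sum_prod_type]
  refine Finset.sum_congr rfl fun a _ => Finset.sum_congr rfl fun b _ => ?_
  rw [ContinuousMultilinearMap.map_smul_univ, Fin.prod_univ_two, coeff_eq_iteratedFDeriv e hF,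
    smul_eq_mul]
  simp only [finTwoArrowEquiv_symm_apply, Matrix.cons_val_zero, Matrix.cons_val_one]
  congr 2
  funext i
  fin_cases i <;> rfl

/-- **Slade, proof of Corollary 8.1.6, display (8.24): `|D²F(φ; f, f)| ≤ 2‖F‖_{T_φ}‖f‖²_Φ`**
("By definition of the `T_φ`-seminorm"), for the lattice norm `Φ(𝔥)` and a direction
`f = Σ_x f_x e_x` in the span of the coordinate directions, `‖f‖_Φ ≤ c` meaning
`|∇^β f_x| ≤ c 𝔥 R^{-|β|}` for admissible `β` (the field, or the constant test function `𝟙`,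
"regarded as a test function"); requires `p_𝒩 ≥ 2`.
[cite: Slade2017, §8.1 (proof of Corollary 8.1.6, display |D²F(0;f,f)| ≤ 2‖F‖_{T_{0,N}}‖f‖²_{Φ_N})] [cite: BrydgesSlade2015RGI, Definition 3.4.1] -/
theorem abs_iteratedFDeriv_two_le_lattice {𝔥 R : ℝ} (h𝔥 : 0 < 𝔥) (hR : 0 < R) {pΦ pN : ℕ}
    (hpN : 2 ≤ pN) (e : Λ × ι → E) {F : E → ℝ} (hF : ContDiff ℝ ∞ F) (φ : E) (f : Λ × ι → ℝ)
    {c : ℝ} (hc : 0 ≤ c)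
    (hf : ∀ (x : Λ × ι) (β : List (ℕ × S)), Adm pΦ 1 β →
      |napply step β (liftFn f) [x]| ≤ c * 𝔥 * (R ^ β.length)⁻¹) :
    |iteratedFDeriv ℝ 2 F φ (fun _ => ∑ x : Λ × ι, f x • e x)| ≤
      2 * TphiNorm pN (latticeFamily step 𝔥 R pΦ) e F φ * c ^ 2 := by
  rw [iteratedFDeriv_two_apply_sum e hF φ f]
  have hp := pairing_prodFn_one_one hpN (coeffFamily e F φ) (liftFn f) (liftFn f)
  simp only [liftFn_singleton, coeffFamily] at hp
  have heq : ∑ a : Λ × ι, ∑ b : Λ × ι, f a * f b * coeff e [a, b] F φ =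
      2 * pairing pN (coeffFamily e F φ) (prodFn 1 1 (liftFn f) (liftFn f)) := by
    rw [hp, ← mul_assoc, mul_inv_cancel₀ (two_ne_zero), one_mul]
    refine Finset.sum_congr rfl fun a _ => Finset.sum_congr rfl fun b _ => ?_
    ring
  rw [heq, abs_mul, abs_two, mul_assoc]
  refine mul_le_mul_of_nonneg_left ?_ zero_le_two
  rw [sq]
  refine abs_pairing_le_Tnorm_mul (latticeFamily_evalBound step h𝔥 hR pΦ pN) _
    (fun z hz => prodFn_eq_zero_of_length _ _ (by omega)) ?_ (mul_nonneg hc hc)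
  refine prodFn_polar step h𝔥 hR hc hc ?_ ?_
  · intro u hu β hβ
    match u, hu with
    | [x], _ => simpa using hf x β hβ
  · intro v hv β hβ
    match v, hv with
    | [x], _ => simpa using hf x β hβ

end consequences

end lattice

end Tphi

end LongRangePhi4

end Literature.Barriers.CriticalPhenomena

end
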